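import Literature.NumberTheory.LFunctions.NoRealZeroCertificateReplayFast
import HarnessLib

/-!
# Kernel replay of the Lu–Zaman–Zhao certificates: segmented row checks (bounded work per kernel call)

Topic `Literature/NumberTheory/LFunctions`. The row checker `rowSearch2` / `checkListK`
(`NoRealZeroCertificateReplayFast.lean`) replays ONE Table-1 certificate of Lu–Zaman–Zhao
(arXiv:2602.03626, §2.1–§3: `rhs < ∑_{p ≤ N} …` of their (2.5)) by walking the verified prime table from
`p = 2` until the accumulated (scaled, lower-bounded) prime sum exceeds the scaled right-hand side. For the
deepest heavy rows of the `q ≤ 4·10⁵` campaign the walk has `1–4·10⁵` prime terms (e.g. `D = −222643`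
needs the primes to `5 881 783`), which in ONE `decide +kernel` call exceeds the measured kernel-memory
guidance (≈ `1.2·10⁵` terms per call). This file splits such a walk into SEGMENTS with claimed intermediate
accumulators, each checked by its own kernel call:

* `rowSumK neg |D| S acc` — the accumulator after adding the selected table values of ALL entries of the
  table segment `S` to `acc` (no stop test; forced to a numeral at every step), with the composition law
  `rowSumK_append`;
* `checkRowFromK T neg |D| acc` — the stop-test search `rowSearch2` over the FINAL segment `T`, started from
  the accumulator `acc` instead of `0` (right-hand side and `r`-enclosure computed by the kernel exactly as in
  `checkListK`);
* the glue `rowSearch2_append_of`: if the search over `T` succeeds from `rowSumK neg |D| S acc`, the search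
  over `S ++ T` succeeds from `acc` (on `S ++ T` it either stops early inside `S`, or arrives at `T` with
  exactly that accumulator);
* **`certifiedAt_of_checkRowFromK`**: over a valid table `S ++ T`, `rowSumK neg |D| S 0 = acc` and
  `checkRowFromK T neg |D| acc = true` give `CertifiedAt (1/5) D` — the same conclusion as
  `certifiedAt_of_checkListK`, so segmented rows enter the HeavyRows assembly unchanged;
* `tableValid_of_eq` — transport of `TableValid` along a re-association of a concatenated table
  (the segments are groups of the verified parts `table<t>P<k>`; `List.append_assoc` re-brackets them).

A prefix `S = S₁ ++ (S₂ ++ … )` is itself evaluated segment by segment: `rowSumK_append` rewrites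
`rowSumK neg |D| (S₁ ++ S') 0` to `rowSumK neg |D| S' (rowSumK neg |D| S₁ 0)` and each inner value is a
separately decided numeral. Definitions and theorems only; nothing is evaluated here; standard axioms.
What is NOT here: any table or row data (those are the `…Table<t>*` / `…Heavy<t>N*` files).

## References

* W. Lu, A. Zaman, K. Zhao, *Dirichlet L-functions of quadratic characters have no exceptional
  zeros for moduli up to 10¹⁰*, Math. Comp. (2026), arXiv:2602.03626, §2.1–§3 and (2.5). [LuZamanZhao2026]
* H. L. Montgomery, R. C. Vaughan, *Multiplicative Number Theory I*, CUP 2007, §9.3 (Euler's criterion,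
  used by `pick2`). [MontgomeryVaughan2007]
-/

namespace Literature.NumberTheory.LFunctions
namespace LuZamanZhao2026
namespace Replay

open Literature.Analysis.ValidatedNumerics Literature.Analysis.ValidatedNumerics.NumericsMP

/-! ## Prefix accumulators -/

/-- **The accumulator of a table segment**: add the selected (scaled, lower-bound) table value
`pick2 neg |D| e` of EVERY entry `e ∈ S` to `acc`, with no stop test; the running value is forced to a
numeral at every step (as in `rowSearch2`) so that the kernel builds no deep chain of additions.
[cite: LuZamanZhao2026, §2.1 (the prime sum of (2.3)/(2.5), accumulated along the prime table)] -/
def rowSumK (neg : Bool) (Dabs : ℕ) : List PRow → ℕ → ℕ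
  | [], acc => acc
  | e :: S, acc =>
    match acc + pick2 neg Dabs e with
    | 0 => rowSumK neg Dabs S 0
    | k + 1 => rowSumK neg Dabs S (k + 1)

/-- One step of `rowSumK` (the forcing `match` is the identity). [folklore] -/
private theorem rowSumK_cons (neg : Bool) (Dabs : ℕ) (e : PRow) (S : List PRow) (acc : ℕ) :
    rowSumK neg Dabs (e :: S) acc = rowSumK neg Dabs S (acc + pick2 neg Dabs e) := by
  rw [rowSumK]
  cases acc + pick2 neg Dabs e <;> rfl

/-- **Composition of segments**: the accumulator over `S ++ T` is the accumulator over `T` started from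
the accumulator over `S` (the prime sum of (2.3) accumulated along consecutive stretches of the prime
table). [cite: LuZamanZhao2026, §2.1 and (2.3)] -/
theorem rowSumK_append (neg : Bool) (Dabs : ℕ) :
    ∀ (S T : List PRow) (acc : ℕ), rowSumK neg Dabs (S ++ T) acc = rowSumK neg Dabs T (rowSumK neg Dabs S acc)
  | [], T, acc => by rw [List.nil_append, rowSumK]
  | e :: S, T, acc => by
    rw [List.cons_append, rowSumK_cons, rowSumK_cons, rowSumK_append neg Dabs S T]

/-- **Chaining decided segment accumulators**: from `rowSumK … S a = b` and `rowSumK … T b = c`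
conclude `rowSumK … (S ++ T) a = c` (term-mode glue for the heavy files; no list is unfolded).
[cite: LuZamanZhao2026, §2.1 and (2.3)] -/
theorem rowSumK_append_eq {neg : Bool} {Dabs : ℕ} {S T : List PRow} {a b c : ℕ}
    (h₁ : rowSumK neg Dabs S a = b) (h₂ : rowSumK neg Dabs T b = c) :
    rowSumK neg Dabs (S ++ T) a = c := by
  rw [rowSumK_append, h₁, h₂]

/-! ## The search from a given accumulator -/

/-- **Segment glue for the search**: if the stop-test search over `T` succeeds when started from the full
accumulator of the segment `S`, then the search over `S ++ T` started from `acc` succeeds (along `S` it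
either stops early — success — or it reaches `T` carrying exactly `rowSumK neg |D| S acc`).
[cite: LuZamanZhao2026, §2.1 and (2.5)] -/
theorem rowSearch2_append_of (neg : Bool) (Dabs hN : ℕ) :
    ∀ (S T : List PRow) (acc : ℕ),
      rowSearch2 neg Dabs hN T (rowSumK neg Dabs S acc) = true →
        rowSearch2 neg Dabs hN (S ++ T) acc = true
  | [], T, acc, h => by
    rw [rowSumK] at h
    rw [List.nil_append]
    exact h
  | e :: S, T, acc, h => by
    rw [rowSumK_cons] at h
    have ih := rowSearch2_append_of neg Dabs hN S T (acc + pick2 neg Dabs e) h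
    rw [List.cons_append]
    unfold rowSearch2
    revert ih
    generalize acc + pick2 neg Dabs e = s
    cases s with
    | zero => exact id
    | succ k =>
      intro ih
      show (bif Nat.ble hN k then true else rowSearch2 neg Dabs hN (S ++ T) (k + 1)) = true
      cases Nat.ble hN k
      · exact ih
      · rfl

/-- **The row check over a final segment from a given accumulator** (for `decide +kernel`): the kernel
computes the enclosure `R ∋ r` (`rI`) and the scaled upper bound `h` of the right-hand side of (2.5) for the
modulus `|D|` (`rhsHi`), then runs the stop-test search `rowSearch2` over `T` from `acc`. With `acc = 0` this
is the test of `checkListK` for the single row `(neg, |D|)`. [cite: LuZamanZhao2026, §2.1 and (2.5)] -/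
def checkRowFromK (T : List PRow) (neg : Bool) (Dabs acc : ℕ) : Bool :=
  match rI with
  | none => false
  | some R =>
    match rhsHi R Dabs with
    | some h => rowSearch2 neg Dabs h.toNat T acc
    | none => false

/-- **Soundness of the segmented row check.** Over a valid table `S ++ T`: if `acc` is the accumulator
of the prefix segment `S` (from `0`) and the search over the final segment `T` from `acc` succeeds, then
`D = sgnD neg |D|` has a Table-1 certificate at `c = 1/5` (row `λ = 1.6`): `CertifiedAt (1/5) D`.
[cite: LuZamanZhao2026, §2.1–§3 and (2.5)] -/
theorem certifiedAt_of_checkRowFromK {S T : List PRow} (hT : TableValid (S ++ T)) {neg : Bool}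
    {Dabs acc : ℕ} (hS : rowSumK neg Dabs S 0 = acc) (h : checkRowFromK T neg Dabs acc = true) :
    CertifiedAt (1 / 5) (sgnD neg Dabs) := by
  unfold checkRowFromK at h
  split at h
  · exact absurd h Bool.false_ne_true
  rename_i R hR
  split at h
  · rename_i hh hrhs
    subst hS
    have hsearch : rowSearch2 neg Dabs hh.toNat (S ++ T) 0 = true :=
      rowSearch2_append_of neg Dabs hh.toNat S T 0 h
    have hrow : rowOK2 R (S ++ T) neg Dabs = true := by
      unfold rowOK2
      rw [hrhs]
      exact hsearch
    rw [rowOK2_eq] at hrow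
    exact certifiedAt_of_rowOK (mem_rI hR) hT hrow
  · exact absurd h Bool.false_ne_true

/-- The unsegmented special case (`S = []`): `checkRowFromK T neg |D| 0` certifies `D` over a valid `T`
(this is `certifiedAt_of_checkListK` for a one-row list). [cite: LuZamanZhao2026, §2.1–§3 and (2.5)] -/
theorem certifiedAt_of_checkRowFromK_zero {T : List PRow} (hT : TableValid T) {neg : Bool} {Dabs : ℕ}
    (h : checkRowFromK T neg Dabs 0 = true) : CertifiedAt (1 / 5) (sgnD neg Dabs) :=
  certifiedAt_of_checkRowFromK (S := []) (by rw [List.nil_append]; exact hT) (by rw [rowSumK]) h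

/-! ## Re-bracketing a concatenated table -/

/-- Transport of table validity along an equation of tables (used with `List.append_assoc` to regroup
the verified parts `table<t>P<k>` of a tier table into walk segments). [cite: LuZamanZhao2026, §2.2 and (2.3)] -/
theorem tableValid_of_eq {T T' : List PRow} (h : T = T') (hT : TableValid T) : TableValid T' :=
  h ▸ hT

/-- A certified row recorded for the discriminant list of a one-row list (the shape consumed by the
HeavyRows assembly: `∀ D ∈ rowsDK rows, CertifiedAt (1/5) D`). [cite: LuZamanZhao2026, §2.1–§3] -/
theorem forall_rowsDK_singleton {neg : Bool} {Dabs : ℕ} (h : CertifiedAt (1 / 5) (sgnD neg Dabs)) :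
    ∀ D ∈ rowsDK [(neg, Dabs)], CertifiedAt (1 / 5) D := by
  intro D hD
  rw [rowsDK, List.map_cons, List.map_nil, List.mem_singleton] at hD
  subst hD
  exact h

end Replay
end LuZamanZhao2026
end Literature.NumberTheory.LFunctions
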